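import Summits.QuantumFields.YangMills.Theorems.BalabanUVNodesRateReadingOfRecord13CoPH
import Literature.MathematicalPhysics.QuantumFieldTheory.Balaban1983to89.Node00.RateRecordW1MapsAdm

/-!
# BalabanUVNodes ∕ node N22 — THE COMPONENT CENSUS OF THE STAGE-13 `CoPH` READING OF RECORD `readingOfRecord₁₃CoPH w1 ℓ₃ ne2 ne1`
# (plan g77 (q1), pub-ymgap INBOX l.23415 ∕ l.23852; W-SEAT-START-LIST v2 § n22 item 3): WHICH K4 SLOT READS WHICH OF THE FOUR DATA, kernel-exact,
# and — inside the W1 component at node00-def-W1's ADMISSIBLE reading `ReadingData.ofRecordAdm` — WHICH W1 FIELDS N22's slot reads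

Cell `pub-ymgap` (HUMAN RULING D-0062 Track A; D-0149 width seats, director-ym №197), seat `pub-ymgap-dag-n22-w3` (WIDTH SEAT 3 of 3 on node n22 = NE9), gen 0.
`--kind proof --supports stmt-QuantumFields-20544 --as helper` (K3⁷ `SpineGivenEndpointR13SepCoPH`).  COUNT-NEUTRAL.  THEOREMS ONLY, 0 `def`, 0 `sorry`; restates nothing
(every face of `Thm/BalabanUVNodesRateReadingOfRecord13CoPH` ∕ `…RateCarriersOfRecord13CoPH(On)` and of `Node00/RateRecordW1MapsAdm` is APPLIED by name); no Theses import.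

THE QUESTION (plan g77 (q1), for K3⁷ skeleton v2 «`𝔯 := readingOfRecord₁₃CoPH <objects by name> <∃ over the rest>`»): of the four data of
`YMDAG.UVSplit.readingOfRecord₁₃CoPH (w1 ℓ₃ ne2 ne1)` (`Thm/BalabanUVNodesRateReadingOfRecord13CoPH.lean` :87), which are LANDED OBJECTS today (by decl name) and which are
parameters?  THE CENSUS (tree state 2026-08-27T23Z; decl names verbatim):
* ALL FOUR ARE PARAMETERS at :87 — `w1 : (F : T4Family) → (θ : Stage13HParams F N) → W1.ReadingData F (MatA N) θ.τ9.M`, `ℓ₃ : T4Family → NE3Letters₁₁`,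
  `ne2 : (F : T4Family) → Stage13HParams F N → (ℕ → ℝ) → List (ULoop F) → ℕ → NE2Objects₁₁`, `ne1 : … → NE1pCarriers`; the ONE pinned-by-name component is N16's LAYER
  `ne3ConstReadingOfRecord₁₁ F N (ℓ₃ F)` (node00-def-RR-1), whose LETTERS `ℓ₃ F` stay parametric.
* `w1` — deepest landed CONSTRUCTORS (node00-def-W1, `Node00/RateRecordW1MapsAdm`): `W1.ReadingData.ofRecordAdm F M N S sp gauge hg T₀ hT₀ li` (run-A ∕ run-B backgrounds :=
  the ADMISSIBLE fields `W1.AdmBg F M N sp k`, readings `(ιU, 0)`, domain pairing `pairOfRecord`) and `W1.ReadingData.ofRecordGen F M N Pplus T₀ S gauge hg li` (`sp := spGen …`,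
  the preservation clause a THEOREM `hT₀_spGen`); deepest landed TOWER currency `S := W1.runTowers (fun k ↦ W1.toClusterTower (𝔇 F θ k).Gn₀)` over a (2.14) TERM-DATUM family
  `𝔇 F θ k : W1.TermData214 …` (`Node00/HistoryTermDatum214`; consumed in n27-c's `Thm/…N27AtTermDatumTowers13CoPH`).  Its INPUTS — the term data `𝔇` (NODE A's kernel
  record `𝒦`, `uOf`, the (2.3) characteristic functions, the (1.41) potentials `𝒱`), the small-field tables `sp` ∕ `Pplus`, the gauge, the transport `T₀`, the letter inputs
  `li` — are PARAMETERS; NO closed term `w1OfRecord : (F : T4Family) → (θ : Stage13HParams F N) → W1.ReadingData F (MatA N) θ.τ9.M` exists (dag-n22-c's W1∕J road J1–J17,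
  node00-def-W1 W1-17c in flight).
* `ℓ₃` — landed PARTIAL names: THE END's `N16Regime.radiusOfRecord N L Nper` ∕ `constOfRecord N L Nper g` (`Thm/…N16RegimeDefs`, `Classical.choose`); the six-letter tuple is
  produced ∃-WISE per family from node N05 ∕ N06 ∕ N07 hypotheses (`N16LettersOfEdgesAllTorus.exists_letters_inEndRegime_leafSlotAT_of_edges`, dag-n16-e 40ᴮ
  `exists_letters_s_N16_readingOfRecord₁₃CoPH_of_thm33Letters_allTorus`); NO closed `ℓ₃OfRecord`.
* `ne2` — landed MODEL OBJECTS by name (node N15 lanes): `N15.UnitLayerBg.c2BgObjects 3 F.hL b aS α β c35 p` (and `c2BgExObjects`, `fullGCovObjects`, `byPartsObjects`,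
  `fullGObjects`, `c2Objects`), entering the reading through the READING EQUATION `hne2 : ne2 F θ g₀ os k = c2BgObjects …` (`θ g₀ os k` idle, numerals free;
  `s_N15_readingOfRecord₁₃CoPH_of_c2Bg_family`); NO Stage-13-keyed `ne2OfRecord₁₃`.
* `ne1` — NO landed object of record: the dressed tower of record is NODE O's (binder B ∕ K2); the only landed producer of an `NE1pCarriers` term is node N14's DECOUPLED MODEL
  `YMDAG.N14.Decoupled.carriers R Λ` (`Thm/…N14DecoupledDressing`).

WHAT IS KERNEL-CHECKED HERE ([bookkeeping]; the (q1) partition as theorems, so that skeleton v2 may place its «∃ over the rest» PER SLOT):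
* §1 (datum-keyed home `RRec₁₃CoPH`) EACH K4 SLOT READS EXACTLY ONE OF THE FOUR DATA: `s_N22 ∕ s_N18 ∕ s_N17 ∕ s_D4_readingOfRecord₁₃CoPH_indep` (the node-U3 slots and the (D4)
  read-out read `w1` ONLY — any `ℓ₃' ne2' ne1'` give the same `Prop`), `s_N16_readingOfRecord₁₃CoPH_indep` (`ℓ₃` only), `s_N15_readingOfRecord₁₃CoPH_indep` (`ne2` only),
  `s_N14_readingOfRecord₁₃CoPH_indep` (`ne1` only); the assembly `k4_readingOfRecord₁₃CoPH_of_donors` (the seven slots at `(w1, ℓ₃, ne2, ne1)` from slots certified at ANY donor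
  readings sharing the one component each slot reads).
* §2 (regime home `RRec₁₃CoPHOn … Rg`, the guarded θ-form K3⁷ reads) the missing faces `s_N14 ∕ s_N17 ∕ s_D4_readingOfRecord₁₃CoPHOn_iff` (N15's is node N15's `N15.AtReadingOfRecord13CoPH.s_N15_readingOfRecord₁₃CoPHOn_iff`, N16 ∕ N18 ∕ N22's are module 6″'s) and the same census
  `s_NXX_readingOfRecord₁₃CoPHOn_indep`, `k4_readingOfRecord₁₃CoPHOn_of_donors`.
* §4 THE OTHER NODE-U3 SLOTS INSIDE `w1` (admissible reading, `Iff.rfl` after the faces): `s_N18_readingAdm₁₃CoPH_indep` (N18 reads the towers `S F θ k`, `S F θ (k+1)`, the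
  tables, the TRANSPORT `T₀`, letters `κ θ₅ C₅` — not the gauge, not `C₀ A μ r s`), `s_D4_readingAdm₁₃CoPH_indep` ((D4) does not read the gauge), `s_N17_readingAdm₁₃CoPH_indep`
  (N17 reads NO W1 object: letters `cr C₅ θ₅ ρ` only).  LOCATED (count-neutral): the closeness GAUGE `LevelPairing.gauge` of W1's pairing is read by NO K4 slot at the reading
  of record (only `T4OutputRate.LipBackground`, not a K4 slot, would read it) — for v2 it may be pinned to anything or ∃-bound at no cost.
* §3 INSIDE `w1` AT THE ADMISSIBLE READING `fun F θ ↦ ReadingData.ofRecordAdm F θ.τ9.M N (S F θ) (sp F θ) (gauge F θ) (hg F θ) (T₀ F θ) (hT₀ F θ) (li F θ)`: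
  `n22At_u3OfRecord₁₃_ofRecordAdm_iff_explicit` (`Iff.rfl`): N22's slot at run length `k` IS «∀ g g′ ∈ ]0, θ.γ], ∀ ADMISSIBLE `U : AdmBg F θ.τ9.M N (sp F θ) k`, ∀ (j, X):
  |Re E(S F θ k)(X; g; (ιU,0)) − Re E(S F θ k)(X; g′; (ιU,0))| ≤ e^{−κ d_j(X)} Σ_{i<j} C₉ ω^{j−i} |g_i − g′_i|» ∧ `FadingMemory C₉ ω (C₉ ω^{·−·})` with `κ = (li F θ).κ` and
  `C₉, ω` THE ANALYTIC BLOCK's at radius `θ.γ` (functions of `θ₅ C₀ A μ r s` of `li F θ`) — so it reads the TOWERS `S`, the TABLES `sp` and SEVEN LETTERS `κ θ₅ C₀ A μ r s`, and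
  NOT the gauge, NOT the transport `T₀` ∕ its clause `hT₀`, NOT run B, NOT the letters `C₅ cr ρ`: `s_N22_readingAdm₁₃CoPH_indep` ∕ `s_N22_readingAdm₁₃CoPHOn_indep` (any
  `gauge' hg' T₀' hT₀'`, any `C₅' cr' ρ'`, any `ℓ₃' ne2' ne1'` give the same `Prop`).  CONSEQUENCE FOR v2: for N22 the «∃ over the rest» may range over
  `gauge ∕ T₀ ∕ hT₀ ∕ C₅ ∕ cr ∕ ρ ∕ ℓ₃ ∕ ne2 ∕ ne1` at no cost; the LOAD-BEARING pins of N22's slot are the towers `S` (the (2.14) terms — W1 road) and the tables `sp`;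
  a junk tower (`EA ≡ 0`) still closes it (`s_N22_readingOfRecord₁₃CoPH_of_EA_zero`, module 6″ §4), so N22's content enters v2 only through a NAMED `S`.

HONEST FRAMING.  Kernel bookkeeping of a reading's DATA DEPENDENCE; no estimate; every node estimate (NE1′, NE2, NE3, NE4, NE5, NE9, (D4)) stays a displayed hypothesis with no
producer asserted here; nothing of Bałaban's is asserted or instantiated; NE9 ∕ fading memory are NOT PRINTED for d = 4 and NOT PROVED; no inhabitant of `IsDatumOfRecord₁₃CCoPH`
∕ `Provisos₁₃CoPH` claimed (K0⁷ `Record13SepCoPHInhabited`, stmt-QuantumFields-20541, OPEN); N22 NOT discharged; K3⁷ NOT claimed; no count claim (the chair's count line is the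
only count; typed 28∕28 · discharged 5∕27, A 5∕28 UNMOVED); one finite four-torus programme at fixed `ε` — R4 closes the CONDITIONAL rung `BalabanLadder.UV` only; the Yang–Mills
mass gap (Clay) is NOT proved by any of this; NOT ℝ⁴, NOT infinite volume, NOT OS, NOT a mass gap.  No decl below carries a cite tag.
-/

noncomputable section

namespace YMDAG.N22.ComponentCensus

open scoped BigOperators
open Literature.MathematicalPhysics.QuantumFieldTheory.Balaban1983to89
open Literature.MathematicalPhysics.QuantumFieldTheory.Balaban1983to89.T4Continuum
open Literature.MathematicalPhysics.QuantumFieldTheory.Balaban1983to89.T4OutputRate (Window NE9 FadingMemory)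
open Literature.MathematicalPhysics.QuantumFieldTheory.Balaban1983to89.Node00
  (Stage13HParams datumOfRecord₁₃CoPH IsDatumOfRecord₁₃CCoPH NE3Letters₁₁ NE2Objects₁₁ MatA ιSU)
open Literature.MathematicalPhysics.QuantumFieldTheory.Balaban1983to89.Node00.Sect2 (domSys CPair ofBackgroundC)
open Literature.MathematicalPhysics.QuantumFieldTheory.Balaban1983to89.Node00.W1 (ReadingData LetterInputs ClusterTower functionalC AdmBg)
open YMDAG.UVSplit

variable {N : ℕ} [NeZero N]

section Generic

variable (w1 w1' : (F : T4Family) → (θ : Stage13HParams F N) → ReadingData F (MatA N) θ.τ9.M) (ℓ₃ ℓ₃' : T4Family → NE3Letters₁₁)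
  (ne2 ne2' : (F : T4Family) → Stage13HParams F N → (ℕ → ℝ) → List (ULoop F) → ℕ → NE2Objects₁₁)
  (ne1 ne1' : (F : T4Family) → Stage13HParams F N → (ℕ → ℝ) → List (ULoop F) → NE1pCarriers)

/-! ## §1 The datum-keyed home `RRec₁₃CoPH (readingOfRecord₁₃CoPH w1 ℓ₃ ne2 ne1)`: each K4 slot reads exactly one of the four data -/

/-- **N22's SLOT READS `w1` ONLY**: replacing `ℓ₃ ∕ ne2 ∕ ne1` by any `ℓ₃' ∕ ne2' ∕ ne1'` leaves `S_N22` at the reading of record unchanged (both sides are «`N22At` at every datum key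
and run length of `(w1 F h.params).u3Objects h.params.γ`», module 6″'s `s_N22_readingOfRecord₁₃CoPH_iff`). -/
theorem s_N22_readingOfRecord₁₃CoPH_indep :
    S_N22 (RRec₁₃CoPH (readingOfRecord₁₃CoPH w1 ℓ₃ ne2 ne1)) ↔ S_N22 (RRec₁₃CoPH (readingOfRecord₁₃CoPH w1 ℓ₃' ne2' ne1')) := by
  rw [s_N22_readingOfRecord₁₃CoPH_iff, s_N22_readingOfRecord₁₃CoPH_iff]

/-- **N18's SLOT READS `w1` ONLY.** -/
theorem s_N18_readingOfRecord₁₃CoPH_indep :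
    S_N18 (RRec₁₃CoPH (readingOfRecord₁₃CoPH w1 ℓ₃ ne2 ne1)) ↔ S_N18 (RRec₁₃CoPH (readingOfRecord₁₃CoPH w1 ℓ₃' ne2' ne1')) := by
  rw [s_N18_readingOfRecord₁₃CoPH_iff, s_N18_readingOfRecord₁₃CoPH_iff]

/-- **N17's SLOT (NE4 on the datum at the dependent letters) READS `w1` ONLY.** -/
theorem s_N17_readingOfRecord₁₃CoPH_indep :
    S_N17 (RRec₁₃CoPH (readingOfRecord₁₃CoPH w1 ℓ₃ ne2 ne1)) ↔ S_N17 (RRec₁₃CoPH (readingOfRecord₁₃CoPH w1 ℓ₃' ne2' ne1')) := by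
  rw [s_N17_readingOfRecord₁₃CoPH_iff, s_N17_readingOfRecord₁₃CoPH_iff]

/-- **THE (D4) READ-OUT SLOT READS `w1` ONLY.** -/
theorem s_D4_readingOfRecord₁₃CoPH_indep :
    S_D4 (RRec₁₃CoPH (readingOfRecord₁₃CoPH w1 ℓ₃ ne2 ne1)) ↔ S_D4 (RRec₁₃CoPH (readingOfRecord₁₃CoPH w1 ℓ₃' ne2' ne1')) := by
  rw [s_D4_readingOfRecord₁₃CoPH_iff, s_D4_readingOfRecord₁₃CoPH_iff]

/-- **N16's SLOT READS `ℓ₃` ONLY** (it is ONE sentence per keyed family about RR-1's constant layer `ne3ConstLayerOfRecord₁₁ F N (ℓ₃ F)`): any `w1' ∕ ne2' ∕ ne1'` give the same `Prop`. -/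
theorem s_N16_readingOfRecord₁₃CoPH_indep :
    S_N16 (RRec₁₃CoPH (readingOfRecord₁₃CoPH w1 ℓ₃ ne2 ne1)) ↔ S_N16 (RRec₁₃CoPH (readingOfRecord₁₃CoPH w1' ℓ₃ ne2' ne1')) := by
  rw [s_N16_readingOfRecord₁₃CoPH_iff, s_N16_readingOfRecord₁₃CoPH_iff]

/-- **N15's SLOT READS `ne2` ONLY**: any `w1' ∕ ℓ₃' ∕ ne1'` give the same `Prop`. -/
theorem s_N15_readingOfRecord₁₃CoPH_indep :
    S_N15 (RRec₁₃CoPH (readingOfRecord₁₃CoPH w1 ℓ₃ ne2 ne1)) ↔ S_N15 (RRec₁₃CoPH (readingOfRecord₁₃CoPH w1' ℓ₃' ne2 ne1')) := by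
  rw [s_N15_readingOfRecord₁₃CoPH_iff, s_N15_readingOfRecord₁₃CoPH_iff]

/-- **N14's SLOT READS `ne1` ONLY**: any `w1' ∕ ℓ₃' ∕ ne2'` give the same `Prop`. -/
theorem s_N14_readingOfRecord₁₃CoPH_indep :
    S_N14 (RRec₁₃CoPH (readingOfRecord₁₃CoPH w1 ℓ₃ ne2 ne1)) ↔ S_N14 (RRec₁₃CoPH (readingOfRecord₁₃CoPH w1' ℓ₃' ne2' ne1)) := by
  rw [s_N14_readingOfRecord₁₃CoPH_iff, s_N14_readingOfRecord₁₃CoPH_iff]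

/-- **ASSEMBLY FROM DONORS (datum-keyed home)**: the seven K4 slots at the reading `(w1, ℓ₃, ne2, ne1)` follow from slots certified at ANY donor readings that share, slot by slot,
the ONE component the slot reads — N14 from a donor carrying `ne1`, N15 from one carrying `ne2`, N16 from one carrying `ℓ₃`, N17 ∕ N18 ∕ N22 ∕ (D4) from donors carrying `w1`
(so skeleton v2's «∃ over the rest» may be opened independently per slot). -/
theorem k4_readingOfRecord₁₃CoPH_of_donors
    (h14 : S_N14 (RRec₁₃CoPH (readingOfRecord₁₃CoPH w1' ℓ₃' ne2' ne1))) (h15 : S_N15 (RRec₁₃CoPH (readingOfRecord₁₃CoPH w1' ℓ₃' ne2 ne1')))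
    (h16 : S_N16 (RRec₁₃CoPH (readingOfRecord₁₃CoPH w1' ℓ₃ ne2' ne1'))) (h17 : S_N17 (RRec₁₃CoPH (readingOfRecord₁₃CoPH w1 ℓ₃' ne2' ne1')))
    (h18 : S_N18 (RRec₁₃CoPH (readingOfRecord₁₃CoPH w1 ℓ₃' ne2' ne1'))) (h22 : S_N22 (RRec₁₃CoPH (readingOfRecord₁₃CoPH w1 ℓ₃' ne2' ne1')))
    (hD4 : S_D4 (RRec₁₃CoPH (readingOfRecord₁₃CoPH w1 ℓ₃' ne2' ne1'))) :
    S_N14 (RRec₁₃CoPH (readingOfRecord₁₃CoPH w1 ℓ₃ ne2 ne1)) ∧ S_N15 (RRec₁₃CoPH (readingOfRecord₁₃CoPH w1 ℓ₃ ne2 ne1)) ∧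
      S_N16 (RRec₁₃CoPH (readingOfRecord₁₃CoPH w1 ℓ₃ ne2 ne1)) ∧ S_N17 (RRec₁₃CoPH (readingOfRecord₁₃CoPH w1 ℓ₃ ne2 ne1)) ∧
      S_N18 (RRec₁₃CoPH (readingOfRecord₁₃CoPH w1 ℓ₃ ne2 ne1)) ∧ S_N22 (RRec₁₃CoPH (readingOfRecord₁₃CoPH w1 ℓ₃ ne2 ne1)) ∧
      S_D4 (RRec₁₃CoPH (readingOfRecord₁₃CoPH w1 ℓ₃ ne2 ne1)) :=
  ⟨(s_N14_readingOfRecord₁₃CoPH_indep w1 w1' ℓ₃ ℓ₃' ne2 ne2' ne1).mpr h14, (s_N15_readingOfRecord₁₃CoPH_indep w1 w1' ℓ₃ ℓ₃' ne2 ne1 ne1').mpr h15,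
    (s_N16_readingOfRecord₁₃CoPH_indep w1 w1' ℓ₃ ne2 ne2' ne1 ne1').mpr h16, (s_N17_readingOfRecord₁₃CoPH_indep w1 ℓ₃ ℓ₃' ne2 ne2' ne1 ne1').mpr h17,
    (s_N18_readingOfRecord₁₃CoPH_indep w1 ℓ₃ ℓ₃' ne2 ne2' ne1 ne1').mpr h18, (s_N22_readingOfRecord₁₃CoPH_indep w1 ℓ₃ ℓ₃' ne2 ne2' ne1 ne1').mpr h22,
    (s_D4_readingOfRecord₁₃CoPH_indep w1 ℓ₃ ℓ₃' ne2 ne2' ne1 ne1').mpr hD4⟩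

/-! ## §2 The regime home `RRec₁₃CoPHOn (readingOfRecord₁₃CoPH w1 ℓ₃ ne2 ne1) Rg` (guarded θ-form): the three missing faces and the same census -/

variable (Rg : (F : T4Family) → Stage13HParams F N → Prop)

/-- **N14 AT THE REGIME-RESTRICTED READING OF RECORD** (guarded θ-form): NE1′ at the residual dressed tower of every admissible tuple with provisos in `Rg` (layer B's
`s_N14_rRec₁₃CoPHOn_iff`, component `rfl`). -/
theorem s_N14_readingOfRecord₁₃CoPHOn_iff :
    S_N14 (RRec₁₃CoPHOn (readingOfRecord₁₃CoPH w1 ℓ₃ ne2 ne1) Rg) ↔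
      ∀ (F : T4Family) (θ : Stage13HParams F N), θ.Provisos₁₃CoPH F N → Rg F θ → θ.Admissible F N → ∀ (g₀ : ℕ → ℝ) (os : List (ULoop F)), N14At (ne1 F θ g₀ os) :=
  s_N14_rRec₁₃CoPHOn_iff _ Rg

/-- **N17 AT THE REGIME-RESTRICTED READING OF RECORD** (guarded θ-form, on the datum `datumOfRecord₁₃CoPH F N θ hP`): NE4 at the dependent letters of W1's bundle (`g₀`, `os` idle). -/
theorem s_N17_readingOfRecord₁₃CoPHOn_iff :
    S_N17 (RRec₁₃CoPHOn (readingOfRecord₁₃CoPH w1 ℓ₃ ne2 ne1) Rg) ↔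
      ∀ (F : T4Family) (θ : Stage13HParams F N) (hP : θ.Provisos₁₃CoPH F N), Rg F θ → θ.Admissible F N → ∀ k : ℕ,
        N17At (datumOfRecord₁₃CoPH F N θ hP) (u3OfRecord₁₃ θ.toStage13Params ((w1 F θ).u3Objects θ.γ) k) := by
  rw [s_N17_rRec₁₃CoPHOn_iff]
  exact ⟨fun H F θ hP hRg hθ k => H F θ hP hRg hθ (fun _ => 0) [] k, fun H F θ hP hRg hθ _ _ k => H F θ hP hRg hθ k⟩

/-- **(D4) AT THE REGIME-RESTRICTED READING OF RECORD** (guarded θ-form, on the datum): the β-read-out binders at W1's bundles (`g₀`, `os` idle). -/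
theorem s_D4_readingOfRecord₁₃CoPHOn_iff :
    S_D4 (RRec₁₃CoPHOn (readingOfRecord₁₃CoPH w1 ℓ₃ ne2 ne1) Rg) ↔
      ∀ (F : T4Family) (θ : Stage13HParams F N) (hP : θ.Provisos₁₃CoPH F N), Rg F θ → θ.Admissible F N → ∀ k : ℕ,
        ReadOutAt (datumOfRecord₁₃CoPH F N θ hP) (u3OfRecord₁₃ θ.toStage13Params ((w1 F θ).u3Objects θ.γ) k) := by
  rw [s_D4_rRec₁₃CoPHOn_iff]
  exact ⟨fun H F θ hP hRg hθ k => H F θ hP hRg hθ (fun _ => 0) [] k, fun H F θ hP hRg hθ _ _ k => H F θ hP hRg hθ k⟩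

/-- **N22's SLOT READS `w1` ONLY** (regime home). -/
theorem s_N22_readingOfRecord₁₃CoPHOn_indep :
    S_N22 (RRec₁₃CoPHOn (readingOfRecord₁₃CoPH w1 ℓ₃ ne2 ne1) Rg) ↔ S_N22 (RRec₁₃CoPHOn (readingOfRecord₁₃CoPH w1 ℓ₃' ne2' ne1') Rg) := by
  rw [s_N22_readingOfRecord₁₃CoPHOn_iff, s_N22_readingOfRecord₁₃CoPHOn_iff]

/-- **N18's SLOT READS `w1` ONLY** (regime home). -/
theorem s_N18_readingOfRecord₁₃CoPHOn_indep :
    S_N18 (RRec₁₃CoPHOn (readingOfRecord₁₃CoPH w1 ℓ₃ ne2 ne1) Rg) ↔ S_N18 (RRec₁₃CoPHOn (readingOfRecord₁₃CoPH w1 ℓ₃' ne2' ne1') Rg) := by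
  rw [s_N18_readingOfRecord₁₃CoPHOn_iff, s_N18_readingOfRecord₁₃CoPHOn_iff]

/-- **N17's SLOT READS `w1` ONLY** (regime home). -/
theorem s_N17_readingOfRecord₁₃CoPHOn_indep :
    S_N17 (RRec₁₃CoPHOn (readingOfRecord₁₃CoPH w1 ℓ₃ ne2 ne1) Rg) ↔ S_N17 (RRec₁₃CoPHOn (readingOfRecord₁₃CoPH w1 ℓ₃' ne2' ne1') Rg) := by
  rw [s_N17_readingOfRecord₁₃CoPHOn_iff, s_N17_readingOfRecord₁₃CoPHOn_iff]

/-- **THE (D4) SLOT READS `w1` ONLY** (regime home). -/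
theorem s_D4_readingOfRecord₁₃CoPHOn_indep :
    S_D4 (RRec₁₃CoPHOn (readingOfRecord₁₃CoPH w1 ℓ₃ ne2 ne1) Rg) ↔ S_D4 (RRec₁₃CoPHOn (readingOfRecord₁₃CoPH w1 ℓ₃' ne2' ne1') Rg) := by
  rw [s_D4_readingOfRecord₁₃CoPHOn_iff, s_D4_readingOfRecord₁₃CoPHOn_iff]

/-- **N16's SLOT READS `ℓ₃` ONLY** (regime home). -/
theorem s_N16_readingOfRecord₁₃CoPHOn_indep :
    S_N16 (RRec₁₃CoPHOn (readingOfRecord₁₃CoPH w1 ℓ₃ ne2 ne1) Rg) ↔ S_N16 (RRec₁₃CoPHOn (readingOfRecord₁₃CoPH w1' ℓ₃ ne2' ne1') Rg) := by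
  rw [s_N16_readingOfRecord₁₃CoPHOn_iff, s_N16_readingOfRecord₁₃CoPHOn_iff]

/-- **N15's SLOT READS `ne2` ONLY** (regime home; layer B's `s_N15_rRec₁₃CoPHOn_iff` — its θ-form at this reading is node N15's
`N15.AtReadingOfRecord13CoPH.s_N15_readingOfRecord₁₃CoPHOn_iff`, not restated here). -/
theorem s_N15_readingOfRecord₁₃CoPHOn_indep :
    S_N15 (RRec₁₃CoPHOn (readingOfRecord₁₃CoPH w1 ℓ₃ ne2 ne1) Rg) ↔ S_N15 (RRec₁₃CoPHOn (readingOfRecord₁₃CoPH w1' ℓ₃' ne2 ne1') Rg) := by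
  rw [s_N15_rRec₁₃CoPHOn_iff, s_N15_rRec₁₃CoPHOn_iff]
  exact Iff.rfl

/-- **N14's SLOT READS `ne1` ONLY** (regime home). -/
theorem s_N14_readingOfRecord₁₃CoPHOn_indep :
    S_N14 (RRec₁₃CoPHOn (readingOfRecord₁₃CoPH w1 ℓ₃ ne2 ne1) Rg) ↔ S_N14 (RRec₁₃CoPHOn (readingOfRecord₁₃CoPH w1' ℓ₃' ne2' ne1) Rg) := by
  rw [s_N14_readingOfRecord₁₃CoPHOn_iff, s_N14_readingOfRecord₁₃CoPHOn_iff]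

/-- **ASSEMBLY FROM DONORS (regime home, any `Rg`)** — the guarded θ-form of `k4_readingOfRecord₁₃CoPH_of_donors`. -/
theorem k4_readingOfRecord₁₃CoPHOn_of_donors
    (h14 : S_N14 (RRec₁₃CoPHOn (readingOfRecord₁₃CoPH w1' ℓ₃' ne2' ne1) Rg)) (h15 : S_N15 (RRec₁₃CoPHOn (readingOfRecord₁₃CoPH w1' ℓ₃' ne2 ne1') Rg))
    (h16 : S_N16 (RRec₁₃CoPHOn (readingOfRecord₁₃CoPH w1' ℓ₃ ne2' ne1') Rg)) (h17 : S_N17 (RRec₁₃CoPHOn (readingOfRecord₁₃CoPH w1 ℓ₃' ne2' ne1') Rg))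
    (h18 : S_N18 (RRec₁₃CoPHOn (readingOfRecord₁₃CoPH w1 ℓ₃' ne2' ne1') Rg)) (h22 : S_N22 (RRec₁₃CoPHOn (readingOfRecord₁₃CoPH w1 ℓ₃' ne2' ne1') Rg))
    (hD4 : S_D4 (RRec₁₃CoPHOn (readingOfRecord₁₃CoPH w1 ℓ₃' ne2' ne1') Rg)) :
    S_N14 (RRec₁₃CoPHOn (readingOfRecord₁₃CoPH w1 ℓ₃ ne2 ne1) Rg) ∧ S_N15 (RRec₁₃CoPHOn (readingOfRecord₁₃CoPH w1 ℓ₃ ne2 ne1) Rg) ∧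
      S_N16 (RRec₁₃CoPHOn (readingOfRecord₁₃CoPH w1 ℓ₃ ne2 ne1) Rg) ∧ S_N17 (RRec₁₃CoPHOn (readingOfRecord₁₃CoPH w1 ℓ₃ ne2 ne1) Rg) ∧
      S_N18 (RRec₁₃CoPHOn (readingOfRecord₁₃CoPH w1 ℓ₃ ne2 ne1) Rg) ∧ S_N22 (RRec₁₃CoPHOn (readingOfRecord₁₃CoPH w1 ℓ₃ ne2 ne1) Rg) ∧
      S_D4 (RRec₁₃CoPHOn (readingOfRecord₁₃CoPH w1 ℓ₃ ne2 ne1) Rg) :=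
  ⟨(s_N14_readingOfRecord₁₃CoPHOn_indep w1 w1' ℓ₃ ℓ₃' ne2 ne2' ne1 Rg).mpr h14, (s_N15_readingOfRecord₁₃CoPHOn_indep w1 w1' ℓ₃ ℓ₃' ne2 ne1 ne1' Rg).mpr h15,
    (s_N16_readingOfRecord₁₃CoPHOn_indep w1 w1' ℓ₃ ne2 ne2' ne1 ne1' Rg).mpr h16, (s_N17_readingOfRecord₁₃CoPHOn_indep w1 ℓ₃ ℓ₃' ne2 ne2' ne1 ne1' Rg).mpr h17,
    (s_N18_readingOfRecord₁₃CoPHOn_indep w1 ℓ₃ ℓ₃' ne2 ne2' ne1 ne1' Rg).mpr h18, (s_N22_readingOfRecord₁₃CoPHOn_indep w1 ℓ₃ ℓ₃' ne2 ne2' ne1 ne1' Rg).mpr h22,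
    (s_D4_readingOfRecord₁₃CoPHOn_indep w1 ℓ₃ ℓ₃' ne2 ne2' ne1 ne1' Rg).mpr hD4⟩

end Generic

/-! ## §3 Inside `w1` at node00-def-W1's ADMISSIBLE reading: N22's slot reads the towers `S`, the tables `sp` and seven letters — not the gauge, not the transport, not run B -/

section Admissible

variable
  (S : (F : T4Family) → (θ : Stage13HParams F N) → (k : ℕ) → ClusterTower (F.P k) (MatA N) θ.τ9.M)
  (sp : (F : T4Family) → (θ : Stage13HParams F N) → (k j : ℕ) → (domSys (F.P k) θ.τ9.M j).Dom → Set (CPair (F.P k) (MatA N)))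
  (gauge gauge' : (F : T4Family) → (θ : Stage13HParams F N) → (k : ℕ) → GaugeField (F.P k) 0 (Node00.SU N) → GaugeField (F.P k) 0 (Node00.SU N) → ℝ)
  (hg : ∀ (F : T4Family) (θ : Stage13HParams F N) (k : ℕ) (U U' : GaugeField (F.P k) 0 (Node00.SU N)), 0 ≤ gauge F θ k U U')
  (hg' : ∀ (F : T4Family) (θ : Stage13HParams F N) (k : ℕ) (U U' : GaugeField (F.P k) 0 (Node00.SU N)), 0 ≤ gauge' F θ k U U')
  (T₀ T₀' : (F : T4Family) → (θ : Stage13HParams F N) → (k : ℕ) → GaugeField (F.P (k + 1)) 0 (Node00.SU N) → GaugeField (F.P k) 0 (Node00.SU N))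
  (hT₀ : ∀ (F : T4Family) (θ : Stage13HParams F N) (k : ℕ) (U : GaugeField (F.P (k + 1)) 0 (Node00.SU N)),
    (∀ (j : ℕ) (Y : (domSys (F.P (k + 1)) θ.τ9.M j).Dom), ofBackgroundC (ιSU N) U ∈ sp F θ (k + 1) j Y) →
    ∀ (j : ℕ) (Y : (domSys (F.P k) θ.τ9.M j).Dom), ofBackgroundC (ιSU N) (T₀ F θ k U) ∈ sp F θ k j Y)
  (hT₀' : ∀ (F : T4Family) (θ : Stage13HParams F N) (k : ℕ) (U : GaugeField (F.P (k + 1)) 0 (Node00.SU N)),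
    (∀ (j : ℕ) (Y : (domSys (F.P (k + 1)) θ.τ9.M j).Dom), ofBackgroundC (ιSU N) U ∈ sp F θ (k + 1) j Y) →
    ∀ (j : ℕ) (Y : (domSys (F.P k) θ.τ9.M j).Dom), ofBackgroundC (ιSU N) (T₀' F θ k U) ∈ sp F θ k j Y)
  (li : (F : T4Family) → Stage13HParams F N → LetterInputs) (C₅' cr' ρ' : (F : T4Family) → Stage13HParams F N → ℝ)
  (ℓ₃ ℓ₃' : T4Family → NE3Letters₁₁)
  (ne2 ne2' : (F : T4Family) → Stage13HParams F N → (ℕ → ℝ) → List (ULoop F) → ℕ → NE2Objects₁₁)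
  (ne1 ne1' : (F : T4Family) → Stage13HParams F N → (ℕ → ℝ) → List (ULoop F) → NE1pCarriers)

/-- **WHAT N22's SLOT IS, AT RUN LENGTH `k`, INSIDE THE ADMISSIBLE W1 READING** (`Iff.rfl`): the JOINT history-Lipschitz inequality for `Re E(S F θ k)(X; ·; (ιU, 0))` over
ADMISSIBLE run-A fields `U : AdmBg F θ.τ9.M N (sp F θ) k` on the window `]0, θ.γ]`, with decay letter `(li F θ).κ` and moduli `C₉·ω^{j−i}`, AND `FadingMemory C₉ ω (C₉·ω^{·−·})`,
where `C₉ = (32 ∕ (s²·min(r∕2, θ.γ∕2)))·(C₀^{1−s}(2A)^{s}) ∕ (θ₅^{1−s}μ^{s})`, `ω = θ₅^{1−s}μ^{s}` are the analytic block's letters at radius `θ.γ` — a `Prop` about `S F θ k`,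
`sp F θ k` and the seven letters `κ θ₅ C₀ A μ r s` of `li F θ`; the gauge, the transport, run B and the letters `C₅ cr ρ` do not occur. -/
theorem n22At_u3OfRecord₁₃_ofRecordAdm_iff_explicit {F : T4Family} (θ : Stage13HParams F N) (k : ℕ) :
    N22At (u3OfRecord₁₃ θ.toStage13Params
        ((ReadingData.ofRecordAdm F θ.τ9.M N (S F θ) (sp F θ) (gauge F θ) (hg F θ) (T₀ F θ) (hT₀ F θ) (li F θ)).u3Objects θ.γ) k) ↔
      (∀ g ∈ Window θ.γ, ∀ g' ∈ Window θ.γ, ∀ (U : AdmBg F θ.τ9.M N (sp F θ) k) (X : Node00.W1.Dom (F.P k) θ.τ9.M),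
          |(functionalC (S F θ k) g (ofBackgroundC (ιSU N) U.1) X).re - (functionalC (S F θ k) g' (ofBackgroundC (ιSU N) U.1) X).re| ≤
            Real.exp (-((li F θ).κ * (domSys (F.P k) θ.τ9.M X.1).dj X.2)) *
              ∑ i ∈ Finset.range X.1,
                32 / ((li F θ).s ^ 2 * min ((li F θ).r / 2) (θ.γ / 2)) * ((li F θ).C₀ ^ (1 - (li F θ).s) * (2 * (li F θ).A) ^ (li F θ).s) /
                    ((li F θ).θ₅ ^ (1 - (li F θ).s) * (li F θ).μ ^ (li F θ).s) *
                  ((li F θ).θ₅ ^ (1 - (li F θ).s) * (li F θ).μ ^ (li F θ).s) ^ (X.1 - i) * |g i - g' i|) ∧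
        FadingMemory
          (32 / ((li F θ).s ^ 2 * min ((li F θ).r / 2) (θ.γ / 2)) * ((li F θ).C₀ ^ (1 - (li F θ).s) * (2 * (li F θ).A) ^ (li F θ).s) /
            ((li F θ).θ₅ ^ (1 - (li F θ).s) * (li F θ).μ ^ (li F θ).s))
          ((li F θ).θ₅ ^ (1 - (li F θ).s) * (li F θ).μ ^ (li F θ).s)
          (fun a i => 32 / ((li F θ).s ^ 2 * min ((li F θ).r / 2) (θ.γ / 2)) * ((li F θ).C₀ ^ (1 - (li F θ).s) * (2 * (li F θ).A) ^ (li F θ).s) /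
              ((li F θ).θ₅ ^ (1 - (li F θ).s) * (li F θ).μ ^ (li F θ).s) *
            ((li F θ).θ₅ ^ (1 - (li F θ).s) * (li F θ).μ ^ (li F θ).s) ^ (a - i)) :=
  Iff.rfl

/-- **`S_N22` AT THE ADMISSIBLE READING OF RECORD, EXPLICIT** (datum-keyed home): the inequality-and-fading-memory sentence of `n22At_u3OfRecord₁₃_ofRecordAdm_iff_explicit` at every
Stage-13 datum key `h.params` and run length. -/
theorem s_N22_readingAdm₁₃CoPH_iff_explicit :
    S_N22 (RRec₁₃CoPH (readingOfRecord₁₃CoPH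
        (fun F θ => ReadingData.ofRecordAdm F θ.τ9.M N (S F θ) (sp F θ) (gauge F θ) (hg F θ) (T₀ F θ) (hT₀ F θ) (li F θ)) ℓ₃ ne2 ne1)) ↔
      ∀ (F : T4Family) (D : Datum F N) (h : IsDatumOfRecord₁₃CCoPH F N D) (k : ℕ),
        (∀ g ∈ Window h.params.γ, ∀ g' ∈ Window h.params.γ, ∀ (U : AdmBg F h.params.τ9.M N (sp F h.params) k) (X : Node00.W1.Dom (F.P k) h.params.τ9.M),
            |(functionalC (S F h.params k) g (ofBackgroundC (ιSU N) U.1) X).re - (functionalC (S F h.params k) g' (ofBackgroundC (ιSU N) U.1) X).re| ≤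
              Real.exp (-((li F h.params).κ * (domSys (F.P k) h.params.τ9.M X.1).dj X.2)) *
                ∑ i ∈ Finset.range X.1,
                  32 / ((li F h.params).s ^ 2 * min ((li F h.params).r / 2) (h.params.γ / 2)) *
                        ((li F h.params).C₀ ^ (1 - (li F h.params).s) * (2 * (li F h.params).A) ^ (li F h.params).s) /
                      ((li F h.params).θ₅ ^ (1 - (li F h.params).s) * (li F h.params).μ ^ (li F h.params).s) *
                    ((li F h.params).θ₅ ^ (1 - (li F h.params).s) * (li F h.params).μ ^ (li F h.params).s) ^ (X.1 - i) * |g i - g' i|) ∧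
          FadingMemory
            (32 / ((li F h.params).s ^ 2 * min ((li F h.params).r / 2) (h.params.γ / 2)) *
                ((li F h.params).C₀ ^ (1 - (li F h.params).s) * (2 * (li F h.params).A) ^ (li F h.params).s) /
              ((li F h.params).θ₅ ^ (1 - (li F h.params).s) * (li F h.params).μ ^ (li F h.params).s))
            ((li F h.params).θ₅ ^ (1 - (li F h.params).s) * (li F h.params).μ ^ (li F h.params).s)
            (fun a i => 32 / ((li F h.params).s ^ 2 * min ((li F h.params).r / 2) (h.params.γ / 2)) *
                  ((li F h.params).C₀ ^ (1 - (li F h.params).s) * (2 * (li F h.params).A) ^ (li F h.params).s) /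
                ((li F h.params).θ₅ ^ (1 - (li F h.params).s) * (li F h.params).μ ^ (li F h.params).s) *
              ((li F h.params).θ₅ ^ (1 - (li F h.params).s) * (li F h.params).μ ^ (li F h.params).s) ^ (a - i)) := by
  rw [s_N22_readingOfRecord₁₃CoPH_iff]
  exact Iff.rfl

/-- **N22's SLOT DOES NOT READ THE GAUGE, THE TRANSPORT, RUN B, OR THE LETTERS `C₅ cr ρ`** (datum-keyed home): replacing `gauge hg T₀ hT₀` by any `gauge' hg' T₀' hT₀'` (same
tables `sp`), the letters `C₅ cr ρ` of `li` by any `C₅' cr' ρ'`, and `ℓ₃ ne2 ne1` by any `ℓ₃' ne2' ne1'` leaves `S_N22` at the admissible reading of record unchanged; the towers `S`,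
the tables `sp` and the letters `κ θ₅ C₀ A μ r s` are what it reads. -/
theorem s_N22_readingAdm₁₃CoPH_indep :
    S_N22 (RRec₁₃CoPH (readingOfRecord₁₃CoPH
        (fun F θ => ReadingData.ofRecordAdm F θ.τ9.M N (S F θ) (sp F θ) (gauge F θ) (hg F θ) (T₀ F θ) (hT₀ F θ) (li F θ)) ℓ₃ ne2 ne1)) ↔
    S_N22 (RRec₁₃CoPH (readingOfRecord₁₃CoPH
        (fun F θ => ReadingData.ofRecordAdm F θ.τ9.M N (S F θ) (sp F θ) (gauge' F θ) (hg' F θ) (T₀' F θ) (hT₀' F θ)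
          { li F θ with C₅ := C₅' F θ, cr := cr' F θ, ρ := ρ' F θ }) ℓ₃' ne2' ne1')) := by
  rw [s_N22_readingAdm₁₃CoPH_iff_explicit, s_N22_readingAdm₁₃CoPH_iff_explicit]

/-- **`S_N22` AT THE ADMISSIBLE READING OF RECORD, EXPLICIT** (regime home, any `Rg`; guarded θ-form). -/
theorem s_N22_readingAdm₁₃CoPHOn_iff_explicit (Rg : (F : T4Family) → Stage13HParams F N → Prop) :
    S_N22 (RRec₁₃CoPHOn (readingOfRecord₁₃CoPH
        (fun F θ => ReadingData.ofRecordAdm F θ.τ9.M N (S F θ) (sp F θ) (gauge F θ) (hg F θ) (T₀ F θ) (hT₀ F θ) (li F θ)) ℓ₃ ne2 ne1) Rg) ↔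
      ∀ (F : T4Family) (θ : Stage13HParams F N), θ.Provisos₁₃CoPH F N → Rg F θ → θ.Admissible F N → ∀ k : ℕ,
        (∀ g ∈ Window θ.γ, ∀ g' ∈ Window θ.γ, ∀ (U : AdmBg F θ.τ9.M N (sp F θ) k) (X : Node00.W1.Dom (F.P k) θ.τ9.M),
            |(functionalC (S F θ k) g (ofBackgroundC (ιSU N) U.1) X).re - (functionalC (S F θ k) g' (ofBackgroundC (ιSU N) U.1) X).re| ≤
              Real.exp (-((li F θ).κ * (domSys (F.P k) θ.τ9.M X.1).dj X.2)) *
                ∑ i ∈ Finset.range X.1,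
                  32 / ((li F θ).s ^ 2 * min ((li F θ).r / 2) (θ.γ / 2)) * ((li F θ).C₀ ^ (1 - (li F θ).s) * (2 * (li F θ).A) ^ (li F θ).s) /
                      ((li F θ).θ₅ ^ (1 - (li F θ).s) * (li F θ).μ ^ (li F θ).s) *
                    ((li F θ).θ₅ ^ (1 - (li F θ).s) * (li F θ).μ ^ (li F θ).s) ^ (X.1 - i) * |g i - g' i|) ∧
          FadingMemory
            (32 / ((li F θ).s ^ 2 * min ((li F θ).r / 2) (θ.γ / 2)) * ((li F θ).C₀ ^ (1 - (li F θ).s) * (2 * (li F θ).A) ^ (li F θ).s) /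
              ((li F θ).θ₅ ^ (1 - (li F θ).s) * (li F θ).μ ^ (li F θ).s))
            ((li F θ).θ₅ ^ (1 - (li F θ).s) * (li F θ).μ ^ (li F θ).s)
            (fun a i => 32 / ((li F θ).s ^ 2 * min ((li F θ).r / 2) (θ.γ / 2)) * ((li F θ).C₀ ^ (1 - (li F θ).s) * (2 * (li F θ).A) ^ (li F θ).s) /
                ((li F θ).θ₅ ^ (1 - (li F θ).s) * (li F θ).μ ^ (li F θ).s) *
              ((li F θ).θ₅ ^ (1 - (li F θ).s) * (li F θ).μ ^ (li F θ).s) ^ (a - i)) := by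
  rw [s_N22_readingOfRecord₁₃CoPHOn_iff]
  exact Iff.rfl

/-- **N22's SLOT DOES NOT READ THE GAUGE, THE TRANSPORT, RUN B, OR THE LETTERS `C₅ cr ρ`** (regime home, any `Rg` — the guarded θ-form K3⁷'s composer reads). -/
theorem s_N22_readingAdm₁₃CoPHOn_indep (Rg : (F : T4Family) → Stage13HParams F N → Prop) :
    S_N22 (RRec₁₃CoPHOn (readingOfRecord₁₃CoPH
        (fun F θ => ReadingData.ofRecordAdm F θ.τ9.M N (S F θ) (sp F θ) (gauge F θ) (hg F θ) (T₀ F θ) (hT₀ F θ) (li F θ)) ℓ₃ ne2 ne1) Rg) ↔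
    S_N22 (RRec₁₃CoPHOn (readingOfRecord₁₃CoPH
        (fun F θ => ReadingData.ofRecordAdm F θ.τ9.M N (S F θ) (sp F θ) (gauge' F θ) (hg' F θ) (T₀' F θ) (hT₀' F θ)
          { li F θ with C₅ := C₅' F θ, cr := cr' F θ, ρ := ρ' F θ }) ℓ₃' ne2' ne1') Rg) := by
  rw [s_N22_readingAdm₁₃CoPHOn_iff_explicit, s_N22_readingAdm₁₃CoPHOn_iff_explicit]

/-! ## §4 The other node-U3 slots inside `w1` at the admissible reading: NOBODY reads the gauge; N18 and (D4) read the transport; N17 reads letters only -/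

variable (S' : (F : T4Family) → (θ : Stage13HParams F N) → (k : ℕ) → ClusterTower (F.P k) (MatA N) θ.τ9.M)
  (sp' : (F : T4Family) → (θ : Stage13HParams F N) → (k j : ℕ) → (domSys (F.P k) θ.τ9.M j).Dom → Set (CPair (F.P k) (MatA N)))
  (T₀'' : (F : T4Family) → (θ : Stage13HParams F N) → (k : ℕ) → GaugeField (F.P (k + 1)) 0 (Node00.SU N) → GaugeField (F.P k) 0 (Node00.SU N))
  (hT₀'' : ∀ (F : T4Family) (θ : Stage13HParams F N) (k : ℕ) (U : GaugeField (F.P (k + 1)) 0 (Node00.SU N)),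
    (∀ (j : ℕ) (Y : (domSys (F.P (k + 1)) θ.τ9.M j).Dom), ofBackgroundC (ιSU N) U ∈ sp' F θ (k + 1) j Y) →
    ∀ (j : ℕ) (Y : (domSys (F.P k) θ.τ9.M j).Dom), ofBackgroundC (ιSU N) (T₀'' F θ k U) ∈ sp' F θ k j Y)
  (κ' C₀' A' μ' r' s' : (F : T4Family) → Stage13HParams F N → ℝ)

/-- **N18's SLOT DOES NOT READ THE GAUGE NOR THE REGULARITY LETTERS `C₀ A μ r s`** (datum-keyed home; it reads the towers `S F θ k` AND `S F θ (k+1)`, the tables `sp`, the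
transport `T₀` and the letters `κ θ₅ C₅` — dag-n18-d's `n18At_u3OfRecord₁₃_readingAdm_iff` is its explicit form): any `gauge' hg'`, `C₀' A' μ' r' s'`, `ℓ₃' ne2' ne1'` give the same `Prop`. -/
theorem s_N18_readingAdm₁₃CoPH_indep :
    S_N18 (RRec₁₃CoPH (readingOfRecord₁₃CoPH
        (fun F θ => ReadingData.ofRecordAdm F θ.τ9.M N (S F θ) (sp F θ) (gauge F θ) (hg F θ) (T₀ F θ) (hT₀ F θ) (li F θ)) ℓ₃ ne2 ne1)) ↔
    S_N18 (RRec₁₃CoPH (readingOfRecord₁₃CoPH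
        (fun F θ => ReadingData.ofRecordAdm F θ.τ9.M N (S F θ) (sp F θ) (gauge' F θ) (hg' F θ) (T₀ F θ) (hT₀ F θ)
          { li F θ with C₀ := C₀' F θ, A := A' F θ, μ := μ' F θ, r := r' F θ, s := s' F θ }) ℓ₃' ne2' ne1')) := by
  rw [s_N18_readingOfRecord₁₃CoPH_iff, s_N18_readingOfRecord₁₃CoPH_iff]
  exact Iff.rfl

/-- **THE (D4) READ-OUT SLOT DOES NOT READ THE GAUGE** (datum-keyed home; it reads both runs' functionals — towers, tables, transport — and the letters): any `gauge' hg'`,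
`ℓ₃' ne2' ne1'` give the same `Prop`.  With §3 and `s_N18 ∕ s_N17_readingAdm₁₃CoPH_indep`: the closeness GAUGE of W1's level pairing is read by NO K4 slot at the reading of record. -/
theorem s_D4_readingAdm₁₃CoPH_indep :
    S_D4 (RRec₁₃CoPH (readingOfRecord₁₃CoPH
        (fun F θ => ReadingData.ofRecordAdm F θ.τ9.M N (S F θ) (sp F θ) (gauge F θ) (hg F θ) (T₀ F θ) (hT₀ F θ) (li F θ)) ℓ₃ ne2 ne1)) ↔
    S_D4 (RRec₁₃CoPH (readingOfRecord₁₃CoPH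
        (fun F θ => ReadingData.ofRecordAdm F θ.τ9.M N (S F θ) (sp F θ) (gauge' F θ) (hg' F θ) (T₀ F θ) (hT₀ F θ) (li F θ)) ℓ₃' ne2' ne1')) := by
  rw [s_D4_readingOfRecord₁₃CoPH_iff, s_D4_readingOfRecord₁₃CoPH_iff]
  exact Iff.rfl

/-- **N17's SLOT READS NO W1 OBJECT AT ALL — ONLY THE LETTERS `cr C₅ θ₅ ρ` (and `θ.γ`, the datum)**: any towers `S'`, tables `sp'`, gauge, transport `T₀''`, letters
`κ' C₀' A' μ' r' s'` and `ℓ₃' ne2' ne1'` give the same `Prop` (NE4 on the datum at the dependent letters is level-free and object-free). -/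
theorem s_N17_readingAdm₁₃CoPH_indep :
    S_N17 (RRec₁₃CoPH (readingOfRecord₁₃CoPH
        (fun F θ => ReadingData.ofRecordAdm F θ.τ9.M N (S F θ) (sp F θ) (gauge F θ) (hg F θ) (T₀ F θ) (hT₀ F θ) (li F θ)) ℓ₃ ne2 ne1)) ↔
    S_N17 (RRec₁₃CoPH (readingOfRecord₁₃CoPH
        (fun F θ => ReadingData.ofRecordAdm F θ.τ9.M N (S' F θ) (sp' F θ) (gauge' F θ) (hg' F θ) (T₀'' F θ) (hT₀'' F θ)
          { li F θ with κ := κ' F θ, C₀ := C₀' F θ, A := A' F θ, μ := μ' F θ, r := r' F θ, s := s' F θ }) ℓ₃' ne2' ne1')) := by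
  rw [s_N17_readingOfRecord₁₃CoPH_iff, s_N17_readingOfRecord₁₃CoPH_iff]
  exact Iff.rfl

end Admissible

end YMDAG.N22.ComponentCensus

end
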